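import Summits.CriticalPhenomena.CardyFormulaZ2.Theorems.CardyFlipRussoVoronoiHubFromSmirnovStepBadMeasure
import Summits.CriticalPhenomena.CardyFormulaZ2.Theorems.CardyFlipRussoVoronoiHubFromSmirnovVoidConsequences
import Summits.CriticalPhenomena.CardyFormulaZ2.Theorems.CardyFlipRussoVoronoiHubFromSmirnovPotDefBound
import Summits.CriticalPhenomena.CardyFormulaZ2.Theorems.CardyFlipRussoVoronoiHubFromSmirnovMeasurablePotDef
import Summits.CriticalPhenomena.CardyFormulaZ2.Theorems.CardyFlipRussoVoronoiHubFromSmirnovArmLoc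
import Summits.CriticalPhenomena.CardyFormulaZ2.Theorems.CardyFlipRussoVoronoiHubFromSmirnovTransportCoupling
import Mathlib
import HarnessLib

/-!
# Stub `perSquare_bound` (Core-C2 of the one-arm route) of line `moebius-exact-delaunay-dilation-ward`
# (crux `VoronoiHubFromSmirnov`, stmt-CriticalPhenomena-6433)

THE PER-SQUARE BOUND.  The abstract one-step bound `stepBad_measure_le_R` (landed module
`…StepBadMeasure`: `μ(stepBad i ∩ good) ≤ 3 p B + N p² B + N² p³` for abstract local supersets
`DefLoc k` of the defect events and `Arm r₁ r₂` of the chain-arm events) is instantiated with the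
CONCRETE local events of the route, on the no-void event
`𝒢 = {c | ∀ z ∈ Kc, ∃ x ∈ c.1, dist x (z/δ) < r_v}` and for the window `W = {b | δ b ∈ V}`:

* `DefLoc k` = the union of the four potential-defect events (near-tied navel / close pair, for the
  nuclei in the disc `closedBall (sqCentre u k) (2u)` and for their transported images under
  `transportMap g δ`), which contains the defect event of the square `k` on `𝒢` by hypothesis; it
  is measurable (`measurableSet_potDef`), localised on the disc (the events only read
  `(c.1 ∪ c.2) ∩ disc`), and of probability `≤ p` by `potDef_bound_hom` / `potDef_bound_transport`
  (monotonicity `NearTie.mono` / `ClosePair.mono` for the homogeneous pair, the window identity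
  `{b | δ b ∈ closedBall (δ z) (δ r)} = closedBall z r` for the transported pair).
* `Arm r₁ r₂` = the chain-arm event for the adjacency read in the band
  `D = {r₁ - 4u ≤ dist · (sqCentre u i) ≤ r₂ + 4u}` with chain nuclei in the thinner band
  `D' = {r₁ - u ≤ · ≤ r₂ + u}`: it contains the window chain arm on `𝒢` (`vc_armLoc_of_chainArm`,
  step bound `2 r_v ≤ u` from `vc_dist_le_of_adjEuc`), is the preimage of a measurable graph
  crossing event (`armLoc_eq_preimage_graphCross`, `measurableSet_graphCross`), and has
  probability `≤ Ca (r₁/r₂)^ηa + v` by the arm hypothesis at scale `ℓ = 2 r_v`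
  (`cthickening (6 r_v) D' ⊆ D`) and the global void bound (a `r_v`-void over
  `cthickening (4 r_v) D'` is a void at a point of `V ⊆ Kc`).

References: I. Benjamini, O. Schramm, Comm. Math. Phys. 197 (1998) §§4–5; V. Tassion, Ann. Probab.
44 (2016) Thm 3.  No new definitions; tree facts and Mathlib only.
-/

noncomputable section

namespace Summit.CriticalPhenomena.CardyFormulaZ2.Cruxes.VoronoiHubFromSmirnov.MoebiusExactDelaunayDilationWard

open Set MeasureTheory Metric
open Literature.Analysis.FunctionSpaces

/-! ### Elementary helpers -/

/-- The configuration-coordinate window of a physical disc `closedBall (δ z) (δ r)` is the disc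
`closedBall z r`. -/
theorem psb_window_closedBall {δ : ℝ} (hδ : 0 < δ) (z : ℂ) (r : ℝ) :
    {b : ℂ | (δ : ℂ) * b ∈ closedBall ((δ : ℂ) * z) (δ * r)} = closedBall z r := by
  ext b
  rw [mem_setOf_eq, mem_closedBall, mem_closedBall, dist_real_mul δ hδ b z]
  exact mul_le_mul_iff_right₀ hδ

/-- Restricting both colours to `D` does not change the nuclei read in `D`:
`((c.1|D) ∪ (c.2|D)) ∩ D = (c.1 ∪ c.2) ∩ D`. -/
theorem psb_union_restrict_inter (D : Set ℂ) (c : PointConfig ℂ × PointConfig ℂ) :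
    ((PointConfig.restrict D c.1 : Set ℂ) ∪ (PointConfig.restrict D c.2 : Set ℂ)) ∩ D =
      ((c.1 : Set ℂ) ∪ (c.2 : Set ℂ)) ∩ D := by
  simp only [PointConfig.coe_eq_carrier, PointConfig.carrier_restrict]
  rw [← union_inter_distrib_right, inter_assoc, inter_self]

/-- The closed `ε`-thickening of the band `{a ≤ dist · z ≤ b}` lies in the band
`{a - ε ≤ dist · z ≤ b + ε}` (closed bands in the proper space `ℂ`; triangle inequality). -/
theorem psb_cthickening_band_subset (z : ℂ) (a b : ℝ) {ε : ℝ} (hε : 0 ≤ ε) :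
    cthickening ε {x : ℂ | a ≤ dist x z ∧ dist x z ≤ b} ⊆
      {x : ℂ | a - ε ≤ dist x z ∧ dist x z ≤ b + ε} := by
  have hc : Continuous fun x : ℂ => dist x z := continuous_id.dist continuous_const
  have hcl : IsClosed {x : ℂ | a ≤ dist x z ∧ dist x z ≤ b} := by
    rw [setOf_and]
    exact (isClosed_le continuous_const hc).inter (isClosed_le hc continuous_const)
  rw [hcl.cthickening_eq_biUnion_closedBall hε]
  intro x hx
  obtain ⟨y, hy, hxy⟩ := mem_iUnion₂.1 hx
  rw [mem_closedBall] at hxy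
  exact ⟨by linarith [hy.1, dist_triangle y x z, dist_comm x y],
    by linarith [hy.2, dist_triangle x y z]⟩

/-- The carrier `K ∩ δ • D'` of the localised arm event is measurable. -/
theorem psb_measurableSet_inter_image {K D' : Set ℂ} (hK : MeasurableSet K)
    (hD' : MeasurableSet D') {δ : ℝ} (hδ : 0 < δ) :
    MeasurableSet (K ∩ (fun x : ℂ => (δ : ℂ) * x) '' D') := by
  have hδ0 : (δ : ℂ) ≠ 0 := Complex.ofReal_ne_zero.2 hδ.ne'
  have himg : (fun x : ℂ => (δ : ℂ) * x) '' D' = (fun x : ℂ => (δ : ℂ)⁻¹ * x) ⁻¹' D' := by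
    ext x
    simp only [mem_image, mem_preimage]
    constructor
    · rintro ⟨y, hy, rfl⟩
      rwa [inv_mul_cancel_left₀ hδ0]
    · intro hx
      exact ⟨(δ : ℂ)⁻¹ * x, hx, mul_inv_cancel_left₀ hδ0 x⟩
  rw [himg]
  exact hK.inter (hD'.preimage (measurable_id.const_mul _))

/-- Subadditivity for a union of four sets (outer measure; no measurability). -/
theorem psb_measureReal_union₄_le {α : Type*} [MeasurableSpace α] (μ : Measure α)
    (A B C D : Set α) : μ.real (A ∪ B ∪ C ∪ D) ≤ μ.real A + μ.real B + μ.real C + μ.real D := by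
  have h1 := measureReal_union_le (μ := μ) (A ∪ B ∪ C) D
  have h2 := measureReal_union_le (μ := μ) (A ∪ B) C
  have h3 := measureReal_union_le (μ := μ) A B
  linarith

/-! ### The local potential-defect events: monotonicity and the probability bound -/

/-- A near-tied navel among the nuclei in `D` is a near-tied navel among all nuclei. -/
theorem psb_nearTie_local_le (D : Set ℂ) (z : ℂ) (ρ ℓ τ : ℝ) :
    (lawBW (volume : Measure ℂ)).real {c : PointConfig ℂ × PointConfig ℂ |
        NearTie ((((c.1 : Set ℂ) ∪ (c.2 : Set ℂ))) ∩ D) z ρ ℓ τ} ≤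
      (lawBW (volume : Measure ℂ)).real {c : PointConfig ℂ × PointConfig ℂ |
        NearTie (((c.1 : Set ℂ) ∪ (c.2 : Set ℂ))) z ρ ℓ τ} := by
  haveI : IsProbabilityMeasure (lawBW (volume : Measure ℂ)) := isProbabilityMeasure_lawBW_volume
  exact measureReal_mono fun c hc =>
    NearTie.mono hc inter_subset_left (by rw [dist_self, add_zero]) le_rfl le_rfl

/-- A close pair among the nuclei in `D` is a close pair among all nuclei. -/
theorem psb_closePair_local_le (D : Set ℂ) (z : ℂ) (ρ τ : ℝ) :
    (lawBW (volume : Measure ℂ)).real {c : PointConfig ℂ × PointConfig ℂ |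
        ClosePair ((((c.1 : Set ℂ) ∪ (c.2 : Set ℂ))) ∩ D) z ρ τ} ≤
      (lawBW (volume : Measure ℂ)).real {c : PointConfig ℂ × PointConfig ℂ |
        ClosePair (((c.1 : Set ℂ) ∪ (c.2 : Set ℂ))) z ρ τ} := by
  haveI : IsProbabilityMeasure (lawBW (volume : Measure ℂ)) := isProbabilityMeasure_lawBW_volume
  exact measureReal_mono fun c hc =>
    ClosePair.mono hc inter_subset_left (by rw [dist_self, add_zero]) le_rfl

/-- **Probability of the local defect event of one square.**  The union of the four
potential-defect events near `z` (near-tied navel / close pair for the nuclei in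
`closedBall z (2u)`, and for their transported images) has probability at most the sum of the
four bounds of `potDef_bound_hom` / `potDef_bound_transport` (scales `ρ = u + 2 r_v`, `u + 6 r_v`,
`ℓ = 2 r_v` on the Euclidean side and `Λ` times these on the image side). -/
theorem psb_defLoc_bound {g : ℂ → ℂ} {δ r_v Λ u m τ τ' : ℝ} (hδ : 0 < δ) (hrv : 0 < r_v)
    (hΛ : 1 ≤ Λ) (hu : 0 < u) (hτ : 0 < τ) (hτ2 : τ ≤ 2 * r_v) (hτ' : 0 < τ')
    (hτ'2 : τ' ≤ 2 * Λ * r_v) (hg : Measurable g) (hm : 0 < m) (z : ℂ)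
    (hder : ∀ x ∈ closedBall ((δ : ℂ) * z) (δ * (2 * u)),
      HasDerivAt g (deriv g x) x ∧ m ≤ ‖deriv g x‖)
    (hinj : InjOn g (closedBall ((δ : ℂ) * z) (δ * (2 * u)))) :
    (lawBW (volume : Measure ℂ)).real
      ({c : PointConfig ℂ × PointConfig ℂ | NearTie ((((c.1 : Set ℂ) ∪ (c.2 : Set ℂ))) ∩
          closedBall z (2 * u)) z (u + 2 * r_v) (2 * r_v) τ} ∪
        {c : PointConfig ℂ × PointConfig ℂ | ClosePair ((((c.1 : Set ℂ) ∪ (c.2 : Set ℂ))) ∩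
          closedBall z (2 * u)) z (u + 6 * r_v) τ} ∪
        {c : PointConfig ℂ × PointConfig ℂ | NearTie (transportMap g δ ''
          ((((c.1 : Set ℂ) ∪ (c.2 : Set ℂ))) ∩ closedBall z (2 * u))) (transportMap g δ z)
          (Λ * u + 2 * Λ * r_v) (2 * Λ * r_v) τ'} ∪
        {c : PointConfig ℂ × PointConfig ℂ | ClosePair (transportMap g δ ''
          ((((c.1 : Set ℂ) ∪ (c.2 : Set ℂ))) ∩ closedBall z (2 * u))) (transportMap g δ z)
          (Λ * u + 3 * (2 * Λ * r_v)) τ'}) ≤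
      (4 * (u + 2 * r_v) / τ + 1) ^ 2 * (4 * (2 * r_v) / τ) *
          ((36 * Real.pi * 2 * τ * (2 * r_v)) ^ 4 / 24) +
        (4 * (u + 6 * r_v) / τ + 1) ^ 2 * ((2 * Real.pi * (2 * τ) ^ 2) ^ 2 / 2) +
        (4 * (Λ * u + 2 * Λ * r_v) / τ' + 1) ^ 2 * (4 * (2 * Λ * r_v) / τ') *
          ((36 * Real.pi * (2 / m ^ 2) * τ' * (2 * Λ * r_v)) ^ 4 / 24) +
        (4 * (Λ * u + 3 * (2 * Λ * r_v)) / τ' + 1) ^ 2 *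
          (((2 / m ^ 2) * Real.pi * (2 * τ') ^ 2) ^ 2 / 2) := by
  have hΛ0 : 0 < Λ := one_pos.trans_le hΛ
  have hΛu : 0 ≤ Λ * u := by positivity
  have hΛr : 0 ≤ Λ * r_v := by positivity
  have b1 := (potDef_bound_hom z (u + 2 * r_v) (2 * r_v) τ hτ hτ2 (by linarith)).1
  have b2 := (potDef_bound_hom z (u + 6 * r_v) (2 * r_v) τ hτ hτ2 (by linarith)).2
  have b3 := (potDef_bound_transport g (deriv g) (closedBall ((δ : ℂ) * z) (δ * (2 * u))) m δ
    (transportMap g δ z) (Λ * u + 2 * Λ * r_v) (2 * Λ * r_v) τ' hg measurableSet_closedBall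
    isBounded_closedBall hm hδ (fun x hx => (hder x hx).1) (fun x hx => (hder x hx).2) hinj hτ'
    hτ'2 (by linarith)).1
  have b4 := (potDef_bound_transport g (deriv g) (closedBall ((δ : ℂ) * z) (δ * (2 * u))) m δ
    (transportMap g δ z) (Λ * u + 3 * (2 * Λ * r_v)) (2 * Λ * r_v) τ' hg measurableSet_closedBall
    isBounded_closedBall hm hδ (fun x hx => (hder x hx).1) (fun x hx => (hder x hx).2) hinj hτ'
    hτ'2 (by linarith)).2
  rw [psb_window_closedBall hδ] at b3 b4
  refine (psb_measureReal_union₄_le _ _ _ _ _).trans ?_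
  exact add_le_add (add_le_add (add_le_add
    ((psb_nearTie_local_le (closedBall z (2 * u)) z (u + 2 * r_v) (2 * r_v) τ).trans b1)
    ((psb_closePair_local_le (closedBall z (2 * u)) z (u + 6 * r_v) τ).trans b2)) b3) b4

/-! ### The registered stub -/

/-- **Core-C2 of the one-arm route: the per-square bound.**  On the no-void event, the bad event
of one telescoping step at the square `i` has probability `≤ 3 p B + N p² B + N² p³`
(`B = (Ca + v + 1)² ((400u/R)^ηa + v)`, `N = (2(R + 2u)/u + 1)²`), where `p` bounds the sum of the
four potential-defect probabilities of a square and `Ca, ηa, v` are the constants of the localised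
arm bound and of the global void bound: the landed `stepBad_measure_le_R` for the concrete local
events (potential defects on the discs `closedBall (sqCentre u k) (2u)`; chain arms read in the
bands `r₁ - 4u ≤ dist · (sqCentre u i) ≤ r₂ + 4u`). -/
theorem perSquare_bound : ∀ (g : ℂ → ℂ) (V Kc K : Set ℂ) (δ r_v Λ m₁ u R m Ca ηa v p τ τ' : ℝ) (T : Finset (ℤ × ℤ)) (i : ℤ × ℤ), 0 < δ → 0 < r_v → 1 ≤ Λ → V ⊆ Kc → 2 * r_v ≤ u → 0 < u → 1 ≤ 100 * u → K ⊆ Kc → (∀ x ∈ K, Metric.closedBall x m₁ ⊆ V) → MeasurableSet K → 2 * r_v ≤ m₁ / δ - r_v → 0 < τ → τ ≤ 2 * r_v → 0 < τ' → τ' ≤ 2 * Λ * r_v → Measurable g → 0 < m → (∀ k ∈ T, ∀ x ∈ Metric.closedBall ((δ : ℂ) * sqCentre u k) (δ * (2 * u)), HasDerivAt g (deriv g x) x ∧ m ≤ ‖deriv g x‖) → (∀ k ∈ T, Set.InjOn g (Metric.closedBall ((δ : ℂ) * sqCentre u k) (δ * (2 * u)))) → 400 * u < R → (∀ x : ℂ,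 dist x (sqCentre u i) ≤ R + 8 * u → (δ : ℂ) * x ∈ V) → 0 ≤ Ca → 0 < ηa → (∀ (D D' K' : Set ℂ) (z : ℂ) (r₁ r₂ ℓ δ' : ℝ), 0 < δ' → 0 < ℓ → 1 ≤ r₁ → r₁ ≤ r₂ → Metric.cthickening (3 * ℓ) D' ⊆ D → (lawBW (MeasureTheory.volume : MeasureTheory.Measure ℂ)).real {c | ChainArm (adjEuc D c) z r₁ r₂ K' δ' ((c.1 : Set ℂ) ∩ D')} ≤ Ca * (r₁ / r₂) ^ ηa + (lawBW (MeasureTheory.volume : MeasureTheory.Measure ℂ)).real {c | ∃ x ∈ Metric.cthickening (2 * ℓ) D', ∀ y ∈ (c.1 : Set ℂ), ℓ / 2 ≤ dist y x}) → 0 ≤ v → (lawBW (MeasureTheory.volume : MeasureTheory.Measure ℂ)).real {c | ∃ z ∈ Kc, ∀ x ∈ (c.1 : Set ℂ), r_v ≤ dist x (z / (δ : ℂ))} ≤ v → i ∈ T → (∀ k ∈ T, ∀ c : Literature.Analysis.FunctionSpaces.PointConfig ℂ × Literature.Analysis.FunctionSpaces.PointConfig ℂ, (∀ z ∈ Kc,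 ∃ x ∈ (c.1 : Set ℂ), dist x (z / (δ : ℂ)) < r_v) → DefSq (adjEuc {b : ℂ | (δ : ℂ) * b ∈ V} c) (adjPull g V δ c) u k K δ (c.1 : Set ℂ) → NearTie ((((c.1 : Set ℂ) ∪ (c.2 : Set ℂ))) ∩ Metric.closedBall (sqCentre u k) (2 * u)) (sqCentre u k) (u + 2 * r_v) (2 * r_v) τ ∨ ClosePair ((((c.1 : Set ℂ) ∪ (c.2 : Set ℂ))) ∩ Metric.closedBall (sqCentre u k) (2 * u)) (sqCentre u k) (u + 6 * r_v) τ ∨ NearTie (transportMap g δ '' ((((c.1 : Set ℂ) ∪ (c.2 : Set ℂ))) ∩ Metric.closedBall (sqCentre u k) (2 * u))) (transportMap g δ (sqCentre u k)) (Λ * u + 2 * Λ * r_v) (2 * Λ * r_v) τ' ∨ ClosePair (transportMap g δ '' ((((c.1 : Set ℂ) ∪ (c.2 : Set ℂ))) ∩ Metric.closedBall (sqCentre u k) (2 * u))) (transportMap g δ (sqCentre u k)) (Λ * u + 3 * (2 * Λ * r_v)) τ') → (4 * (u + 2 * r_v) / τ + 1) ^ 2 * (4 * (2 * r_v) / τ)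 * ((36 * Real.pi * 2 * τ * (2 * r_v)) ^ 4 / 24) + (4 * (u + 6 * r_v) / τ + 1) ^ 2 * ((2 * Real.pi * (2 * τ) ^ 2) ^ 2 / 2) + (4 * (Λ * u + 2 * Λ * r_v) / τ' + 1) ^ 2 * (4 * (2 * Λ * r_v) / τ') * ((36 * Real.pi * (2 / m ^ 2) * τ' * (2 * Λ * r_v)) ^ 4 / 24) + (4 * (Λ * u + 3 * (2 * Λ * r_v)) / τ' + 1) ^ 2 * (((2 / m ^ 2) * Real.pi * (2 * τ') ^ 2) ^ 2 / 2) ≤ p → (lawBW (MeasureTheory.volume : MeasureTheory.Measure ℂ)).real (stepBad T u R {b : ℂ | (δ : ℂ) * b ∈ V} g V δ K i ∩ {c | ∀ z ∈ Kc, ∃ x ∈ (c.1 : Set ℂ), dist x (z / (δ : ℂ)) < r_v}) ≤ 3 * p * ((Ca + v + 1) ^ 2 * ((400 * u / R) ^ ηa + v)) + (2 * (R + 2 * u) / u + 1) ^ 2 * p ^ 2 * ((Ca + v + 1) ^ 2 * ((400 * u / R) ^ ηa + v)) + ((2 * (R + 2 * u) / u + 1) ^ 2) ^ 2 * p ^ 3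 := by
  intro g V Kc K δ r_v Λ m₁ u R m Ca ηa v p τ τ' T i hδ hrv hΛ hVKc h2rv hu h100u _hKKc hKdeep hKm
    hfit hτ hτ2 hτ' hτ'2 hg hm hder hinj hR hwin hCa hηa harm hv hvbd hi hdefloc hp
  haveI : IsProbabilityMeasure (lawBW (volume : Measure ℂ)) := isProbabilityMeasure_lawBW_volume
  have hδ0 : (δ : ℂ) ≠ 0 := Complex.ofReal_ne_zero.2 hδ.ne'
  -- the concrete local events
  obtain ⟨DefLoc, hDL⟩ : ∃ F : ℤ × ℤ → Set (PointConfig ℂ × PointConfig ℂ), F = fun k =>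
      {c : PointConfig ℂ × PointConfig ℂ | NearTie ((((c.1 : Set ℂ) ∪ (c.2 : Set ℂ))) ∩
          closedBall (sqCentre u k) (2 * u)) (sqCentre u k) (u + 2 * r_v) (2 * r_v) τ} ∪
        {c : PointConfig ℂ × PointConfig ℂ | ClosePair ((((c.1 : Set ℂ) ∪ (c.2 : Set ℂ))) ∩
          closedBall (sqCentre u k) (2 * u)) (sqCentre u k) (u + 6 * r_v) τ} ∪
        {c : PointConfig ℂ × PointConfig ℂ | NearTie (transportMap g δ ''
          ((((c.1 : Set ℂ) ∪ (c.2 : Set ℂ))) ∩ closedBall (sqCentre u k) (2 * u)))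
          (transportMap g δ (sqCentre u k)) (Λ * u + 2 * Λ * r_v) (2 * Λ * r_v) τ'} ∪
        {c : PointConfig ℂ × PointConfig ℂ | ClosePair (transportMap g δ ''
          ((((c.1 : Set ℂ) ∪ (c.2 : Set ℂ))) ∩ closedBall (sqCentre u k) (2 * u)))
          (transportMap g δ (sqCentre u k)) (Λ * u + 3 * (2 * Λ * r_v)) τ'} := ⟨_, rfl⟩
  obtain ⟨Arm, hAD⟩ : ∃ F : ℝ → ℝ → Set (PointConfig ℂ × PointConfig ℂ), F = fun r₁ r₂ =>
      {c : PointConfig ℂ × PointConfig ℂ | ChainArm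
        (adjEuc {x : ℂ | r₁ - 4 * u ≤ dist x (sqCentre u i) ∧ dist x (sqCentre u i) ≤ r₂ + 4 * u} c)
        (sqCentre u i) r₁ r₂ K δ ((c.1 : Set ℂ) ∩
          {x : ℂ | r₁ - u ≤ dist x (sqCentre u i) ∧ dist x (sqCentre u i) ≤ r₂ + u})} := ⟨_, rfl⟩
  obtain ⟨AArm, hAAD⟩ : ∃ F : ℝ → ℝ → Set (PointConfig ℂ × PointConfig ℂ), F = fun r₁ r₂ =>
      graphCross (K ∩ (fun x : ℂ => (δ : ℂ) * x) ''
          {x : ℂ | r₁ - u ≤ dist x (sqCentre u i) ∧ dist x (sqCentre u i) ≤ r₂ + u})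
        (closedBall ((δ : ℂ) * sqCentre u i) (δ * r₁)) (ball ((δ : ℂ) * sqCentre u i) (δ * r₂))ᶜ
        δ := ⟨_, rfl⟩
  -- the defect factor
  have hpB : ∀ k ∈ T, (lawBW (volume : Measure ℂ)).real (DefLoc k) ≤ p := fun k hk => by
    rw [hDL]
    exact (psb_defLoc_bound hδ hrv hΛ hu hτ hτ2 hτ' hτ'2 hg hm (sqCentre u k) (hder k hk)
      (hinj k hk)).trans hp
  have hp0 : 0 ≤ p := measureReal_nonneg.trans (hpB i hi)
  refine stepBad_measure_le_R T u R (2 * u) p v Ca ηa {b : ℂ | (δ : ℂ) * b ∈ V} g V δ K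
    {c | ∀ z ∈ Kc, ∃ x ∈ (c.1 : Set ℂ), dist x (z / (δ : ℂ)) < r_v} DefLoc DefLoc Arm AArm i hu
    hR (by positivity) (by linarith) hp0 hv hCa hηa hi ?_ ?_ ?_ ?_ hpB ?_
  · -- a defect pair in the square forces a local potential defect (hypothesis)
    intro k hk c hc
    simp only [hDL, mem_union, mem_setOf_eq]
    rcases hdefloc k hk c hc.2 hc.1 with h | h | h | h
    · exact Or.inl (Or.inl (Or.inl h))
    · exact Or.inl (Or.inl (Or.inr h))
    · exact Or.inl (Or.inr h)
    · exact Or.inr h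
  · -- a window chain arm is a band chain arm with nuclei in the thinner band
    intro r₁ r₂ _hr₁ hr₁₂ hr₂ c hc
    simp only [hAD, mem_setOf_eq]
    refine vc_armLoc_of_chainArm hu.le hr₁₂ (fun x hx => hwin x (by linarith [hx.2])) rfl
      (fun p' q hp' hq hpK hqK hadj => ?_) hc.1
    have h := vc_dist_le_of_adjEuc hδ hrv hVKc hc.2 (hKdeep _ hpK) hfit hadj
    rw [dist_comm]
    linarith
  · -- the local defect event is measurable and localised on the disc
    intro k hk
    have hTm : Measurable (transportMap g δ) := measurable_transportMap hg δ
    have hTinj : InjOn (transportMap g δ) (closedBall (sqCentre u k) (2 * u)) := by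
      rw [← psb_window_closedBall hδ (sqCentre u k) (2 * u)]
      exact injOn_transportMap (hinj k hk) hδ.ne'
    have m1 := measurableSet_potDef (closedBall (sqCentre u k) (2 * u)) id (sqCentre u k)
      (u + 2 * r_v) (2 * r_v) τ measurableSet_closedBall measurable_id (injOn_id _)
    have m2 := measurableSet_potDef (closedBall (sqCentre u k) (2 * u)) id (sqCentre u k)
      (u + 6 * r_v) (2 * r_v) τ measurableSet_closedBall measurable_id (injOn_id _)
    have m3 := measurableSet_potDef (closedBall (sqCentre u k) (2 * u)) (transportMap g δ)
      (transportMap g δ (sqCentre u k)) (Λ * u + 2 * Λ * r_v) (2 * Λ * r_v) τ'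
      measurableSet_closedBall hTm hTinj
    have m4 := measurableSet_potDef (closedBall (sqCentre u k) (2 * u)) (transportMap g δ)
      (transportMap g δ (sqCentre u k)) (Λ * u + 3 * (2 * Λ * r_v)) (2 * Λ * r_v) τ'
      measurableSet_closedBall hTm hTinj
    simp only [image_id] at m1 m2
    refine ⟨?_, ?_⟩
    · simp only [hDL]
      exact ((m1.1.union m2.2).union m3.1).union m4.2
    · ext c
      simp only [hDL, mem_preimage, mem_union, mem_setOf_eq, psb_union_restrict_inter]
  · -- the local arm event is measurable and localised on the band
    intro r₁ r₂
    simp only [hAD, hAAD]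
    refine ⟨measurableSet_graphCross _ _ _ δ
      (psb_measurableSet_inter_image hKm (sbm_measurableSet_band _ _ _) hδ)
      measurableSet_closedBall measurableSet_ball.compl hδ,
      armLoc_eq_preimage_graphCross _ _ K (sqCentre u i) r₁ r₂ δ hδ ?_⟩
    intro x hx
    exact ⟨by linarith [hx.1], by linarith [hx.2]⟩
  · -- the arm factor: the arm hypothesis at scale `2 r_v` and the global void bound
    intro r₁ r₂ hr₁ hr₁₂ hr₂
    simp only [hAD]
    have hthick : cthickening (3 * (2 * r_v))
        {x : ℂ | r₁ - u ≤ dist x (sqCentre u i) ∧ dist x (sqCentre u i) ≤ r₂ + u} ⊆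
        {x : ℂ | r₁ - 4 * u ≤ dist x (sqCentre u i) ∧ dist x (sqCentre u i) ≤ r₂ + 4 * u} :=
      (psb_cthickening_band_subset (sqCentre u i) (r₁ - u) (r₂ + u) (by positivity)).trans
        fun x hx => ⟨by linarith [hx.1], by linarith [hx.2]⟩
    have h1 := harm {x : ℂ | r₁ - 4 * u ≤ dist x (sqCentre u i) ∧ dist x (sqCentre u i) ≤ r₂ + 4 * u}
      {x : ℂ | r₁ - u ≤ dist x (sqCentre u i) ∧ dist x (sqCentre u i) ≤ r₂ + u} K (sqCentre u i)
      r₁ r₂ (2 * r_v) δ hδ (by positivity) (by linarith) hr₁₂.le hthick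
    have h2 : (lawBW (volume : Measure ℂ)).real {c : PointConfig ℂ × PointConfig ℂ |
        ∃ x ∈ cthickening (2 * (2 * r_v))
          {x : ℂ | r₁ - u ≤ dist x (sqCentre u i) ∧ dist x (sqCentre u i) ≤ r₂ + u},
          ∀ y ∈ (c.1 : Set ℂ), 2 * r_v / 2 ≤ dist y x} ≤ v := by
      refine (measureReal_mono fun c hc => ?_).trans hvbd
      obtain ⟨x, hx, hfar⟩ := hc
      have hx' := psb_cthickening_band_subset (sqCentre u i) (r₁ - u) (r₂ + u) (by positivity) hx
      refine ⟨(δ : ℂ) * x, hVKc (hwin x (by linarith [hx'.2])), fun y hy => ?_⟩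
      rw [mul_div_cancel_left₀ _ hδ0]
      linarith [hfar y hy]
    exact h1.trans (add_le_add le_rfl h2)

end Summit.CriticalPhenomena.CardyFormulaZ2.Cruxes.VoronoiHubFromSmirnov.MoebiusExactDelaunayDilationWard

end
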